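import Summits.AnomalousDissipation.AnomalousDissipation.Theorems.SawtoothPulseCascadeK1LocalisedCascadeNToothInsideSharp

/-!
# K1loc explicit start — helper: SHARP OFF-LOBE WINDOW MASSES, EXACT AND ROUNDED («TwoToothOffLobeSharp»)

Helper file of the prover lane on the crux `K1LocalisedCascade` (stmt-AnomalousDissipation-19491), route `SawtoothPulseCascade`
(arbiter A24-6 (1): table campaign, sharp off-tube constants).  Window forms of `NToothOutsideSharp` / `NToothInsideSharp`:
* **`sum_offLobe_window_sq_norm_nTooth_sharp`**: for a finite window `W` at distance `≥ NE` from both lobes,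
  `Σ_{m∈W} ‖ĝ₀(m)‖² ≤ OUT + [E ≤ |L|]·IN`, `OUT = 2L²/(π²(E+|L|)(E−1)(E+2|L|−1))`, `IN = 1/(π²(E−1)) + 2(|L|−E+1)/(π²|L|E)`;
* **`sum_offLobe_window_sq_norm_twist_of_exact`**: transfer of ANY such off-lobe window bound `M` of the exact chirp to the
  rounded chirp `twist ψ n` with a source shift `|q'| ≤ Q`: `Σ_{m∈W} ‖ĝ(m−q')‖² ≤ (√M + 2πη)²` when `W` keeps distance `≥ NE + Q`.
No definitions; nothing about the crux. [cite: Grafakos2014, Prop. 3.1.2 (5), Prop. 3.2.7 (3)] [problem: turb]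
-/

-- `Summit.<Summit>.<Problem>`: single-conjunct summit, the duplicate namespace segment is deliberate.
set_option linter.dupNamespace false

noncomputable section

namespace Summit.AnomalousDissipation.AnomalousDissipation.Theorems.SawtoothPulseCascade.K1Window

open MeasureTheory Filter Topology UnitAddTorus Complex AddCircle
open scoped Real
open Literature.Analysis Literature.Analysis.FunctionSpaces Literature.Analysis.FunctionSpaces.Torus Literature.Analysis.FluidPDE
open Literature.Analysis.FluidPDE.ShearStage Literature.Analysis.FluidPDE.SawtoothCascade
open Summit.AnomalousDissipation.AnomalousDissipation.Theorems.SawtoothPulseCascade.K1Start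

/-! ## §1 Finite windows away from both lobes, sharp -/

/-- **Off-lobe window mass of the exact chirp, sharp**: for `λ = N·L`, `E ≥ 2` and a finite window `W` with
`NE ≤ ||m| − |λ||` on `W`, `Σ_{m∈W} ‖ĝ₀(m)‖² ≤ OUT + [E ≤ |L|]·IN`. [cite: Grafakos2014, Prop. 3.1.2 (5), Prop. 3.2.7 (3)] -/
theorem sum_offLobe_window_sq_norm_nTooth_sharp {N : ℕ} (hN : 0 < N) {lam L : ℤ} (hL : lam = N * L) {g₀ : UnitAddCircle → ℂ}
    (hg₀ : ∀ t : ℝ, g₀ (t : UnitAddCircle) = Complex.exp (-(2 * π * I * lam * ((tri (2 * π * N * t) / (2 * π * N) : ℝ) : ℂ))))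
    (hg₀c : Continuous g₀) {E : ℕ} (hE : 2 ≤ E) (W : Finset ℤ) (hW : ∀ m ∈ W, (N : ℤ) * E ≤ |(|m| - |lam|)|) :
    ∑ m ∈ W, ‖fourierCoeff g₀ m‖ ^ 2 ≤
      2 * (L : ℝ) ^ 2 / (π ^ 2 * (((E : ℝ) + |(L : ℝ)|) * (((E : ℝ) - 1) * ((E : ℝ) + 2 * |(L : ℝ)| - 1)))) +
        (if (E : ℤ) ≤ |L| then 1 / (π ^ 2 * ((E : ℝ) - 1)) + 2 * (|(L : ℝ)| - E + 1) / (π ^ 2 * (|(L : ℝ)| * E)) else 0) := by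
  classical
  have hπ : 0 < π := Real.pi_pos
  have hE' : (2 : ℝ) ≤ E := by exact_mod_cast hE
  have hNE : (1 : ℤ) ≤ (N : ℤ) * E := by nlinarith [show (1 : ℤ) ≤ N by exact_mod_cast hN, show (2 : ℤ) ≤ E by exact_mod_cast hE]
  set Wo := W.filter (fun m => |lam| + (N : ℤ) * E ≤ |m|) with hWo
  set Wi := W.filter (fun m => ¬ (|lam| + (N : ℤ) * E ≤ |m|)) with hWi
  have hsplit : ∑ m ∈ W, ‖fourierCoeff g₀ m‖ ^ 2 =
      ∑ m ∈ Wo, ‖fourierCoeff g₀ m‖ ^ 2 + ∑ m ∈ Wi, ‖fourierCoeff g₀ m‖ ^ 2 := by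
    rw [hWo, hWi, ← Finset.sum_filter_add_sum_filter_not W (fun m => |lam| + (N : ℤ) * E ≤ |m|)]
  have hout : ∑ m ∈ Wo, ‖fourierCoeff g₀ m‖ ^ 2 ≤
      2 * (L : ℝ) ^ 2 / (π ^ 2 * (((E : ℝ) + |(L : ℝ)|) * (((E : ℝ) - 1) * ((E : ℝ) + 2 * |(L : ℝ)| - 1)))) := by
    refine le_trans ?_ (tsum_outside_sq_norm_nTooth_sharp hN hL hg₀ hg₀c hE)
    have hs : Summable fun m : ℤ => (if |lam| + (N : ℤ) * E ≤ |m| then ‖fourierCoeff g₀ m‖ ^ 2 else 0) :=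
      Summable.of_nonneg_of_le (fun m => by split_ifs <;> positivity)
        (fun m => by split_ifs; exacts [le_rfl, sq_nonneg _]) (hasSum_sq_norm_fourierCoeff_nTooth hg₀ hg₀c).summable
    calc ∑ m ∈ Wo, ‖fourierCoeff g₀ m‖ ^ 2
        = ∑ m ∈ Wo, (if |lam| + (N : ℤ) * E ≤ |m| then ‖fourierCoeff g₀ m‖ ^ 2 else 0) :=
          Finset.sum_congr rfl fun m hm => by rw [hWo, Finset.mem_filter] at hm; rw [if_pos hm.2]
      _ ≤ ∑' m, (if |lam| + (N : ℤ) * E ≤ |m| then ‖fourierCoeff g₀ m‖ ^ 2 else 0) :=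
          hs.sum_le_tsum Wo fun m _ => by split_ifs <;> positivity
  have hin : ∑ m ∈ Wi, ‖fourierCoeff g₀ m‖ ^ 2 ≤
      (if (E : ℤ) ≤ |L| then 1 / (π ^ 2 * ((E : ℝ) - 1)) + 2 * (|(L : ℝ)| - E + 1) / (π ^ 2 * (|(L : ℝ)| * E)) else 0) := by
    have hWisub : Wi ⊆ Finset.Icc (-(|lam| - (N : ℤ) * E)) (|lam| - (N : ℤ) * E) := by
      intro m hm
      rw [hWi, Finset.mem_filter] at hm
      have h1 := hW m hm.1
      have h2 := hm.2
      rw [Finset.mem_Icc, ← abs_le]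
      rw [le_abs] at h1
      omega
    by_cases hEL : (E : ℤ) ≤ |L|
    · rw [if_pos hEL]
      exact (Finset.sum_le_sum_of_subset_of_nonneg hWisub fun _ _ _ => sq_nonneg _).trans
        (sum_inside_sq_norm_nTooth_sharp hN hL hg₀ hE hEL)
    · rw [if_neg hEL]
      have hempty : Wi = ∅ := by
        rw [Finset.eq_empty_iff_forall_notMem]
        intro m hm
        have h := hWisub hm
        rw [Finset.mem_Icc] at h
        have hlam : |lam| = (N : ℤ) * |L| := by rw [hL, abs_mul, Nat.abs_cast]
        have : (N : ℤ) * |L| < (N : ℤ) * E := by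
          have hN1 : (0 : ℤ) < N := by exact_mod_cast hN
          nlinarith
        omega
      rw [hempty, Finset.sum_empty]
  rw [hsplit]
  exact add_le_add hout hin

/-! ## §2 Transfer to the rounded chirp with a source shift -/

/-- **Off-lobe window mass of a ROUNDED chirp from an exact-chirp bound**: let `g₀` be the exact `N`-tooth chirp with lobes `±λ`,
`M` a bound for `Σ_{m∈W'} ‖ĝ₀(m)‖²` over every finite `W'` at distance `≥ NE` from the lobes, `g = twist ψ n` with
`|nψ − f| ≤ η` (`g₀ = e^{−2πif}`), `|q'| ≤ Q`; then for `W` at distance `≥ NE + Q`: `Σ_{m∈W} ‖ĝ(m−q')‖² ≤ (√M + 2πη)²`.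
[cite: Grafakos2014, Prop. 3.1.2 (5), Prop. 3.2.7 (3)] -/
theorem sum_offLobe_window_sq_norm_twist_of_exact (ψ : ShearProfile) (n : ℤ) {N : ℕ} {lam : ℤ}
    {g₀ : UnitAddCircle → ℂ}
    (hg₀ : ∀ t : ℝ, g₀ (t : UnitAddCircle) = Complex.exp (-(2 * π * I * lam * ((tri (2 * π * N * t) / (2 * π * N) : ℝ) : ℂ))))
    (hg₀c : Continuous g₀) {η : ℝ} (hη : ∀ t : ℝ, |n * ψ t - lam * (tri (2 * π * N * t) / (2 * π * N))| ≤ η)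
    {E Q : ℕ} {M : ℝ}
    (hM : ∀ W' : Finset ℤ, (∀ m ∈ W', (N : ℤ) * E ≤ |(|m| - |lam|)|) → ∑ m ∈ W', ‖fourierCoeff g₀ m‖ ^ 2 ≤ M)
    {q' : ℤ} (hq' : |q'| ≤ Q) (W : Finset ℤ) (hW : ∀ m ∈ W, (N : ℤ) * E + Q ≤ |(|m| - |lam|)|) :
    ∑ m ∈ W, ‖fourierCoeff (twist ψ n) (m - q')‖ ^ 2 ≤ (Real.sqrt M + 2 * π * η) ^ 2 := by

  classical
  have hπ : 0 < π := Real.pi_pos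
  have hη0 : 0 ≤ η := (abs_nonneg _).trans (hη 0)
  have hg₀' : ∀ t : ℝ, g₀ (t : UnitAddCircle) = cexp (-(2 * π * I * (((lam * (tri (2 * π * N * t) / (2 * π * N)) : ℝ) : ℂ)))) := by
    intro t; rw [hg₀ t]; push_cast; ring_nf
  have h1 := sqrt_window_shift_twist_le ψ n q' hg₀' hg₀c hη W
  -- the shifted exact window is off-lobe at distance `≥ NE`
  have h2 : ∑ m ∈ W, ‖fourierCoeff g₀ (m - q')‖ ^ 2 ≤ M := by
    rw [← Finset.sum_image (f := fun m : ℤ => ‖fourierCoeff g₀ m‖ ^ 2) (s := W) (g := fun m => m - q')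
      fun a _ b _ h => by simpa using h]
    refine hM _ fun m hm => ?_
    rw [Finset.mem_image] at hm
    obtain ⟨m₀, hm₀, rfl⟩ := hm
    have h := hW m₀ hm₀
    have hq1 := abs_le.1 hq'
    have t1 : |(|m₀ - q'| - |lam|)| ≥ |(|m₀| - |lam|)| - |q'| := by
      have h3 : |(|m₀ - q'| - |lam| - (|m₀| - |lam|))| ≤ |q'| := by
        rw [show |m₀ - q'| - |lam| - (|m₀| - |lam|) = |m₀ - q'| - |m₀| by ring]
        have := abs_abs_sub_abs_le (m₀ - q') m₀
        rw [show m₀ - q' - m₀ = -q' by ring, abs_neg] at this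
        exact this
      have h4 := abs_sub_abs_le_abs_sub (|m₀| - |lam|) (|m₀ - q'| - |lam|)
      rw [show |m₀| - |lam| - (|m₀ - q'| - |lam|) = -(|m₀ - q'| - |lam| - (|m₀| - |lam|)) by ring, abs_neg] at h4
      linarith
    linarith
  have h3 : Real.sqrt (∑ m ∈ W, ‖fourierCoeff (twist ψ n) (m - q')‖ ^ 2) ≤
      Real.sqrt M + 2 * π * η :=
    h1.trans (add_le_add (Real.sqrt_le_sqrt h2) le_rfl)
  have h0 : 0 ≤ ∑ m ∈ W, ‖fourierCoeff (twist ψ n) (m - q')‖ ^ 2 := Finset.sum_nonneg fun _ _ => sq_nonneg _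
  calc ∑ m ∈ W, ‖fourierCoeff (twist ψ n) (m - q')‖ ^ 2
      = Real.sqrt (∑ m ∈ W, ‖fourierCoeff (twist ψ n) (m - q')‖ ^ 2) ^ 2 := (Real.sq_sqrt h0).symm
    _ ≤ (Real.sqrt M + 2 * π * η) ^ 2 :=
        pow_le_pow_left₀ (Real.sqrt_nonneg _) h3 2

end Summit.AnomalousDissipation.AnomalousDissipation.Theorems.SawtoothPulseCascade.K1Window
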